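import Literature.NumberTheory.Transcendental.QuadraticRelationsLogarithmsSec6Fun
import Literature.NumberTheory.Transcendental.QuadraticRelationsLogarithmsProp61
import HarnessLib

/-!
# Roy–Waldschmidt 1997, §6 (iii): the categories `𝒞_ε`, the functions `a_ε, …, r_ε`, Lemme 6.3, and Proposition 6.1 for `𝒞_ε`

D. Roy, M. Waldschmidt, Ann. Sci. ÉNS (4) 30 (1997) 753–796, §6 (iii), pp. 787–788.  For
`ε > 0` with `ε⁻¹ = N` an integer, `𝒞_ε` is the full subcategory of `𝒞` on the objects `X` with
`2d(X)(d(X) + ℓ₁(X)) + 1 ≤ ε⁻¹`, with the functions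
`a_ε = ε⁻²(d₁ - κ)`, `b_ε = ε⁻² max{0, (1-ε)d₀ + d₁ - (2-ε)n + ε²κ_a}`, `c_ε = ε⁻²ℓ₁`,
`d_ε = ε⁻²((2-ε)n - (1-ε)ℓ₀ - ε²ℓ_a)`, `r_ε = ε⁻²d` (all integers).  **Lemme 6.3**: `r_ε, c_ε` are
additive, `a_ε, d_ε` super-additive, `b_ε` sub-additive and bounded by `r_ε`, all vanish where
`r_ε` vanishes; and `r_ε(X) = 0` whenever `b_ε(X) + d_ε(X) = 0`.

This file DEFINES `𝒞_ε` (`Ceps K N`, a subtype of `RWObj K`) and the five functions themselves,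
written out with `N = ε⁻¹` (no rescaling: the paper's functions already carry the factor
`ε⁻² = N²` and are integers): `aE = a_ε = N²(d₁ - κ)`, `bE = b_ε = ((N²-N)d₀ + N²d₁ + κ_a) ∸ (2N²-N)n`
(`= max{0, …}`), `cE = c_ε = N²ℓ₁`, `dE = d_ε = (2N²-N)n ∸ ((N²-N)ℓ₀ + ℓ_a)` (the truncated
subtraction is exact on `𝒞_ε`, `dE_exact`), `rE = r_ε = N²d`; it PROVES Lemme 6.3 (additivity of
`r_ε, c_ε`, super-additivity of `a_ε, d_ε`, sub-additivity of `b_ε`, `b_ε ≤ r_ε`, vanishing of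
`a_ε, b_ε, c_ε, d_ε` where `r_ε` vanishes, and `b_ε + d_ε = 0 ⟹ r_ε = 0`), and instantiates the
relational Proposition 6.1 (`RoyCategory.enonce2_of_enonce1` of `…Prop61.lean`) to `𝒞_ε`:
`Ceps.enonce2_of_enonce1`.  No named facts.

## References

* [RoyWaldschmidt1997ENS] D. Roy, M. Waldschmidt, Ann. Sci. ÉNS (4) 30 (1997) 753–796, §6 (iii),
  Lemme 6.3, pp. 787–788 (read on the rendered scan).
-/

noncomputable section

open Complex IntermediateField Module Submodule

namespace Literature.NumberTheory.Transcendental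

namespace RoyWaldschmidt1997

open LiePresentation

variable {K : IntermediateField ℚ ℂ} {N : ℕ}

/-! ### `𝒞_ε` and the functions -/

/-- The objects of **`𝒞_ε`** (`ε = 1/N`): objects `X` of `𝒞` with `2d(X)(d(X) + ℓ₁(X)) + 1 ≤ ε⁻¹`.
[cite: RoyWaldschmidt1997ENS, §6 (iii), p. 787] -/
def Ceps (K : IntermediateField ℚ ℂ) (N : ℕ) : Type :=
  {X : RWObj K // 2 * X.dd * (X.dd + X.ell₁) + 1 ≤ N}

namespace RWObj

/-- `aE = a_ε(X) = ε⁻²(d₁ - κ) = N²(d₁ - κ)` (`ε = 1/N`). [cite: RoyWaldschmidt1997ENS, §6 (iii), p. 787] -/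
def aE (N : ℕ) (X : RWObj K) : ℕ := N ^ 2 * (X.dd₁ - X.kap)
/-- `bE = b_ε(X) = ε⁻² max{0, (1-ε)d₀ + d₁ - (2-ε)n + ε²κ_a} = max{0, (N²-N)d₀ + N²d₁ + κ_a - (2N²-N)n}`
(`ε = 1/N`; the `max{0, ·}` is the truncated subtraction of `ℕ`). [cite: RoyWaldschmidt1997ENS, §6 (iii), p. 787] -/
def bE (N : ℕ) (X : RWObj K) : ℕ := ((N ^ 2 - N) * X.dd₀ + N ^ 2 * X.dd₁ + X.kapA) - (2 * N ^ 2 - N) * X.nn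
/-- `cE = c_ε(X) = ε⁻²ℓ₁ = N²ℓ₁` (`ε = 1/N`). [cite: RoyWaldschmidt1997ENS, §6 (iii), p. 787] -/
def cE (N : ℕ) (X : RWObj K) : ℕ := N ^ 2 * X.ell₁
/-- `dE = d_ε(X) = ε⁻²((2-ε)n - (1-ε)ℓ₀ - ε²ℓ_a) = (2N²-N)n - (N²-N)ℓ₀ - ℓ_a` (`ε = 1/N`; written as a
truncated subtraction, which is exact on `𝒞_ε`, see `Ceps.dE_exact`). [cite: RoyWaldschmidt1997ENS, §6 (iii), p. 787] -/
def dE (N : ℕ) (X : RWObj K) : ℕ := (2 * N ^ 2 - N) * X.nn - ((N ^ 2 - N) * X.ell₀ + X.ellA)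
/-- `rE = r_ε(X) = ε⁻²d = N²d` (`ε = 1/N`). [cite: RoyWaldschmidt1997ENS, §6 (iii), p. 787] -/
def rE (N : ℕ) (X : RWObj K) : ℕ := N ^ 2 * X.dd

end RWObj

namespace Ceps

/-- The relations of `𝒞_ε` are those of `𝒞`. [cite: RoyWaldschmidt1997ENS, §6 (iii), p. 787] -/
def Quot (X X' : Ceps K N) : Prop := RoyWaldschmidt1997.Quot X.1 X'.1
/-- Kernel-subobjects in `𝒞_ε`. [cite: RoyWaldschmidt1997ENS, §6 (iii), p. 787] -/
def SubO (Xs X : Ceps K N) : Prop := RoyWaldschmidt1997.SubO Xs.1 X.1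
/-- Exact triples in `𝒞_ε`. [cite: RoyWaldschmidt1997ENS, §6 (iii), p. 787] -/
def Exact (Xs X X' : Ceps K N) : Prop := RoyWaldschmidt1997.Exact Xs.1 X.1 X'.1

/-! ### Closure of `𝒞_ε` under kernels and cokernels -/

/-- "tout morphisme de `𝒞` qui est un noyau ou un conoyau d'un morphisme de `𝒞_ε` est aussi un
morphisme de `𝒞_ε`": the kernel object of an exact triple with middle term in `𝒞_ε` is in `𝒞_ε`.
[cite: RoyWaldschmidt1997ENS, §6 (iii), p. 787] -/
theorem mem_of_exact_left {Xs X X' : RWObj K} (h : RoyWaldschmidt1997.Exact Xs X X')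
    (hX : 2 * X.dd * (X.dd + X.ell₁) + 1 ≤ N) : 2 * Xs.dd * (Xs.dd + Xs.ell₁) + 1 ≤ N := by
  have h1 := h.dd_add
  have h2 := h.ell₁_add
  have h3 : Xs.dd ≤ X.dd := by omega
  have h4 : Xs.dd + Xs.ell₁ ≤ X.dd + X.ell₁ := by omega
  exact le_trans (by nlinarith [Nat.mul_le_mul h3 h4]) hX

/-- The cokernel object of an exact triple with middle term in `𝒞_ε` is in `𝒞_ε`.
[cite: RoyWaldschmidt1997ENS, §6 (iii), p. 787] -/
theorem mem_of_exact_right {Xs X X' : RWObj K} (h : RoyWaldschmidt1997.Exact Xs X X')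
    (hX : 2 * X.dd * (X.dd + X.ell₁) + 1 ≤ N) : 2 * X'.dd * (X'.dd + X'.ell₁) + 1 ≤ N := by
  have h1 := h.dd_add
  have h2 := h.ell₁_add
  have h3 : X'.dd ≤ X.dd := by omega
  have h4 : X'.dd + X'.ell₁ ≤ X.dd + X.ell₁ := by omega
  exact le_trans (by nlinarith [Nat.mul_le_mul h3 h4]) hX

/-- `Quot` is reflexive on `𝒞_ε`. [folklore] -/
theorem quot_refl (X : Ceps K N) : Quot X X := RoyWaldschmidt1997.quot_refl X.1
/-- `SubO` is reflexive on `𝒞_ε`. [folklore] -/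
theorem subO_refl (X : Ceps K N) : SubO X X := RoyWaldschmidt1997.subO_refl X.1
/-- `Quot` is transitive on `𝒞_ε`. [folklore] -/
theorem quot_trans (X Y Z : Ceps K N) (h : Quot X Y) (h' : Quot Y Z) : Quot X Z :=
  RoyWaldschmidt1997.quot_trans h h'
/-- `SubO` is transitive on `𝒞_ε`. [folklore] -/
theorem subO_trans (X Y Z : Ceps K N) (h : SubO X Y) (h' : SubO Y Z) : SubO X Z :=
  RoyWaldschmidt1997.subO_trans h h'

/-- Every cokernel in `𝒞_ε` has its kernel object in `𝒞_ε`. [cite: RoyWaldschmidt1997ENS, §6 (iii), p. 787] -/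
theorem quot_exists_exact (X X' : Ceps K N) (h : Quot X X') : ∃ Xs : Ceps K N, Exact Xs X X' := by
  obtain ⟨Xs, hXs⟩ := RoyWaldschmidt1997.quot_exists_exact h
  exact ⟨⟨Xs, mem_of_exact_left hXs X.2⟩, hXs⟩

/-- Every kernel in `𝒞_ε` has its cokernel object in `𝒞_ε`. [cite: RoyWaldschmidt1997ENS, §6 (iii), p. 787] -/
theorem subO_exists_exact (Xs X : Ceps K N) (h : SubO Xs X) : ∃ X' : Ceps K N, Exact Xs X X' := by
  obtain ⟨X', hX'⟩ := RoyWaldschmidt1997.subO_exists_exact h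
  exact ⟨⟨X', mem_of_exact_right hX' X.2⟩, hX'⟩

/-- Exact triples project to `Quot`. [folklore] -/
theorem exact_quot (Xs X X' : Ceps K N) (h : Exact Xs X X') : Quot X X' := RoyWaldschmidt1997.Exact.quot h
/-- Exact triples project to `SubO`. [folklore] -/
theorem exact_subO (Xs X X' : Ceps K N) (h : Exact Xs X X') : SubO Xs X := RoyWaldschmidt1997.Exact.subO h

/-! ### Lemme 6.3 -/

/-- `1 ≤ N` as soon as `𝒞_ε` has an object. [folklore] -/
theorem one_le_N (X : Ceps K N) : 1 ≤ N := le_trans (Nat.le_add_left 1 _) X.2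

/-- `d ≤ N` on `𝒞_ε`. [folklore] -/
theorem dd_le_N (X : Ceps K N) : X.1.dd ≤ N := by
  have := X.2
  rcases Nat.eq_zero_or_pos X.1.dd with h | h
  · omega
  · nlinarith

/-- `ℓ₁ < N` on `𝒞_ε` when `d ≠ 0`. [folklore] -/
theorem ell₁_lt_N (X : Ceps K N) (hd : X.1.dd ≠ 0) : X.1.ell₁ < N := by
  have := X.2
  have h : 1 ≤ X.1.dd := Nat.pos_of_ne_zero hd
  nlinarith

/-- **The truncation in `dE` is exact on `𝒞_ε`**: `(N²-N)ℓ₀ + ℓ_a ≤ (2N²-N)n`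
(`ℓ₀ ≤ n`; `n = 0 ⟹ ℓ_a = 0`; `n ≥ 1 ⟹ ℓ_a ≤ ℓ₁ < N ≤ N²n`). [folklore] -/
theorem dE_exact (X : Ceps K N) : (N ^ 2 - N) * X.1.ell₀ + X.1.ellA ≤ (2 * N ^ 2 - N) * X.1.nn := by
  have hN := one_le_N X
  have h0 := X.1.ell₀_le_nn
  rcases Nat.eq_zero_or_pos X.1.nn with hn | hn
  · rw [X.1.ellA_eq_zero_of_nn hn, hn]
    rw [hn] at h0
    simp [Nat.le_zero.mp h0]
  · have hd : X.1.dd ≠ 0 := by have := X.1.nn_le_dd; omega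
    have h1 := ell₁_lt_N X hd
    have h2 := X.1.ellA_le_ell₁
    have hNN : N ≤ N ^ 2 := by nlinarith
    have h3 : (N ^ 2 - N) * X.1.ell₀ ≤ (N ^ 2 - N) * X.1.nn := Nat.mul_le_mul_left _ h0
    have h4 : X.1.ellA ≤ N ^ 2 * X.1.nn := by nlinarith
    have h5 : (N ^ 2 - N) * X.1.nn + N ^ 2 * X.1.nn = (2 * N ^ 2 - N) * X.1.nn := by
      rw [← Nat.add_mul]; congr 1; omega
    omega

/-- **Lemme 6.3: `r_ε` is additive.** [cite: RoyWaldschmidt1997ENS, Lemme 6.3, p. 788] -/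
theorem rE_add (Xs X X' : Ceps K N) (h : Exact Xs X X') : X.1.rE N = Xs.1.rE N + X'.1.rE N := by
  simp only [RWObj.rE, RoyWaldschmidt1997.Exact.dd_add h]; ring

/-- **Lemme 6.3: `c_ε` is additive.** [cite: RoyWaldschmidt1997ENS, Lemme 6.3, p. 788] -/
theorem cE_add (Xs X X' : Ceps K N) (h : Exact Xs X X') : X.1.cE N = Xs.1.cE N + X'.1.cE N := by
  simp only [RWObj.cE, RoyWaldschmidt1997.Exact.ell₁_add h]; ring

/-- **Lemme 6.3: `a_ε` is super-additive.** [cite: RoyWaldschmidt1997ENS, Lemme 6.3, p. 788] -/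
theorem aE_superadd (Xs X X' : Ceps K N) (h : Exact Xs X X') : Xs.1.aE N + X'.1.aE N ≤ X.1.aE N := by
  simp only [RWObj.aE]
  have h1 := (RoyWaldschmidt1997.Exact.dd₀_add h).2
  have h2 := RoyWaldschmidt1997.Exact.kap_subadd h
  have h3 := Xs.1.kap_le_dd₁
  have h4 := X'.1.kap_le_dd₁
  have h5 := X.1.kap_le_dd₁
  have : Xs.1.dd₁ - Xs.1.kap + (X'.1.dd₁ - X'.1.kap) ≤ X.1.dd₁ - X.1.kap := by omega
  calc N ^ 2 * (Xs.1.dd₁ - Xs.1.kap) + N ^ 2 * (X'.1.dd₁ - X'.1.kap)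
      = N ^ 2 * (Xs.1.dd₁ - Xs.1.kap + (X'.1.dd₁ - X'.1.kap)) := by ring
    _ ≤ N ^ 2 * (X.1.dd₁ - X.1.kap) := Nat.mul_le_mul_left _ this

/-- **Lemme 6.3: `d_ε` is super-additive** (on `𝒞_ε`, where its truncation is exact).
[cite: RoyWaldschmidt1997ENS, Lemme 6.3, p. 788] -/
theorem dE_superadd (Xs X X' : Ceps K N) (h : Exact Xs X X') : Xs.1.dE N + X'.1.dE N ≤ X.1.dE N := by
  simp only [RWObj.dE]
  have h1 := RoyWaldschmidt1997.Exact.nn_superadd h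
  have h2 := RoyWaldschmidt1997.Exact.ell₀_add h
  have h3 := RoyWaldschmidt1997.Exact.ellA_add h
  have es := dE_exact Xs
  have e' := dE_exact X'
  have e := dE_exact X
  have h4 : (2 * N ^ 2 - N) * Xs.1.nn + (2 * N ^ 2 - N) * X'.1.nn ≤ (2 * N ^ 2 - N) * X.1.nn := by
    rw [← Nat.mul_add]; exact Nat.mul_le_mul_left _ h1
  have h5 : (N ^ 2 - N) * X.1.ell₀ = (N ^ 2 - N) * Xs.1.ell₀ + (N ^ 2 - N) * X'.1.ell₀ := by
    rw [h2, Nat.mul_add]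
  omega

/-- **Lemme 6.3: `b_ε` is sub-additive.** [cite: RoyWaldschmidt1997ENS, Lemme 6.3, p. 788] -/
theorem bE_subadd (Xs X X' : Ceps K N) (h : Exact Xs X X') : X.1.bE N ≤ Xs.1.bE N + X'.1.bE N := by
  simp only [RWObj.bE]
  have h0 := RoyWaldschmidt1997.Exact.dd₀_add h
  have h1 := RoyWaldschmidt1997.Exact.nn_superadd h
  have h2 := RoyWaldschmidt1997.Exact.kapA_subadd h
  have h4 : (2 * N ^ 2 - N) * Xs.1.nn + (2 * N ^ 2 - N) * X'.1.nn ≤ (2 * N ^ 2 - N) * X.1.nn := by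
    rw [← Nat.mul_add]; exact Nat.mul_le_mul_left _ h1
  have h5 : (N ^ 2 - N) * X.1.dd₀ = (N ^ 2 - N) * Xs.1.dd₀ + (N ^ 2 - N) * X'.1.dd₀ := by
    rw [h0.1, Nat.mul_add]
  have h6 : N ^ 2 * X.1.dd₁ = N ^ 2 * Xs.1.dd₁ + N ^ 2 * X'.1.dd₁ := by
    rw [h0.2, Nat.mul_add]
  omega

/-- **Lemme 6.3: `b_ε ≤ r_ε`.** [cite: RoyWaldschmidt1997ENS, Lemme 6.3, p. 788] -/
theorem bE_le_rE (X : Ceps K N) : X.1.bE N ≤ X.1.rE N := by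
  simp only [RWObj.bE, RWObj.rE, RWObj.dd, RWObj.dd₀, RWObj.dd₁]
  have hN := one_le_N X
  rcases Nat.eq_zero_or_pos X.1.nn with hn | hn
  · have hk := X.1.kapA_eq_zero_of_nn hn
    rw [hk, hn]
    have : (N ^ 2 - N) * X.1.d₀ ≤ N ^ 2 * X.1.d₀ := Nat.mul_le_mul_right _ (Nat.sub_le _ _)
    have h2 : N ^ 2 * (X.1.d₀ + X.1.d₁) = N ^ 2 * X.1.d₀ + N ^ 2 * X.1.d₁ := Nat.mul_add _ _ _
    omega
  · have hk : X.1.kapA ≤ X.1.dd := (X.1.kapA_le_kap).trans ((X.1.kap_le_dd₁).trans (Nat.le_add_left _ _))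
    have hdN := dd_le_N X
    simp only [RWObj.dd] at hk hdN
    have h1 : X.1.kapA ≤ (2 * N ^ 2 - N) * X.1.nn := by
      have : N ≤ (2 * N ^ 2 - N) * X.1.nn := by
        have h7 : N ≤ 2 * N ^ 2 - N := by
          have : N ^ 2 ≥ N := by nlinarith
          omega
        nlinarith
      omega
    have : (N ^ 2 - N) * X.1.d₀ ≤ N ^ 2 * X.1.d₀ := Nat.mul_le_mul_right _ (Nat.sub_le _ _)
    have h2 : N ^ 2 * (X.1.d₀ + X.1.d₁) = N ^ 2 * X.1.d₀ + N ^ 2 * X.1.d₁ := Nat.mul_add _ _ _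
    omega

/-- **Lemme 6.3: `b_ε` and `c_ε` vanish where `r_ε` vanishes** (then `d = 0`; the part used by
Proposition 6.1 — all four functions vanish, `vanish_of_rE_all`). [cite: RoyWaldschmidt1997ENS, Lemme 6.3, p. 788] -/
theorem vanish_of_rE (X : Ceps K N) (h : X.1.rE N = 0) : X.1.bE N = 0 ∧ X.1.cE N = 0 := by
  have hN := one_le_N X
  simp only [RWObj.rE] at h
  have hd : X.1.dd = 0 := by
    rcases Nat.mul_eq_zero.mp h with h1 | h1
    · exact absurd h1 (by positivity)
    · exact h1
  have hn : X.1.nn = 0 := by have := X.1.nn_le_dd; omega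
  have h1 := X.1.ell₁_eq_zero_of_nn hn
  have h2 := X.1.kapA_eq_zero_of_nn hn
  simp only [RWObj.bE, RWObj.cE, h1, h2, hn, mul_zero, and_true]
  simp only [RWObj.dd, RWObj.dd₀, RWObj.dd₁] at hd ⊢
  have h3 : X.1.d₀ = 0 := by omega
  have h4 : X.1.d₁ = 0 := by omega
  simp [h3, h4]

/-- **Lemme 6.3: `a_ε, b_ε, c_ε, d_ε` all vanish where `r_ε` vanishes** (`r_ε = 0 ⟹ d = 0 ⟹ d₁ = n = 0`).
[cite: RoyWaldschmidt1997ENS, Lemme 6.3, p. 788] -/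
theorem vanish_of_rE_all (X : Ceps K N) (h : X.1.rE N = 0) :
    X.1.aE N = 0 ∧ X.1.bE N = 0 ∧ X.1.cE N = 0 ∧ X.1.dE N = 0 := by
  obtain ⟨hb, hc⟩ := vanish_of_rE X h
  have hN := one_le_N X
  simp only [RWObj.rE] at h
  have hd : X.1.dd = 0 := by
    rcases Nat.mul_eq_zero.mp h with h1 | h1
    · exact absurd h1 (by positivity)
    · exact h1
  have hn : X.1.nn = 0 := by have := X.1.nn_le_dd; omega
  have hd₁ : X.1.dd₁ = 0 := by have : X.1.dd₁ ≤ X.1.dd := Nat.le_add_left _ _; omega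
  refine ⟨?_, hb, hc, ?_⟩
  · simp only [RWObj.aE, hd₁, Nat.zero_sub, mul_zero]
  · simp only [RWObj.dE, hn, mul_zero, Nat.zero_sub]

/-- **Lemme 6.3, last clause** (p. 788): for `X ∈ 𝒞_ε`, `b_ε(X) + d_ε(X) = 0 ⟹ r_ε(X) = 0`
("`b = 0` donne `d ≤ 2n`; `d_ε = 0` donne `2n ≤ ℓ₀`; comme `ℓ₀ ≤ n`, `n = 0` et `d = 0`").
[cite: RoyWaldschmidt1997ENS, Lemme 6.3, p. 788] -/
theorem rE_eq_zero_of_bE_add_dE (X : Ceps K N) (h : X.1.bE N + X.1.dE N = 0) : X.1.rE N = 0 := by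
  have hN := one_le_N X
  have hb : X.1.bE N = 0 := by omega
  have hd : X.1.dE N = 0 := by omega
  have hdE := dE_exact X
  have hl0 := X.1.ell₀_le_nn
  have hnd := X.1.nn_le_dd
  have hdN := dd_le_N X
  have hmem := X.2
  simp only [RWObj.bE, RWObj.dE, RWObj.rE] at hb hd hdE ⊢
  simp only [RWObj.dd] at hnd hdN hmem ⊢
  simp only [RWObj.dd₀, RWObj.dd₁] at *
  -- `d_ε = 0` with exact truncation: `(2N²-N) n = (N²-N) ℓ₀ + ℓ_a`, hence `n = 0`
  have h1 : (2 * N ^ 2 - N) * X.1.nn = (N ^ 2 - N) * X.1.ell₀ + X.1.ellA := by omega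
  have hn : X.1.nn = 0 := by
    by_contra hn0
    have hn1 : 1 ≤ X.1.nn := Nat.pos_of_ne_zero hn0
    have hd0 : X.1.d₀ + X.1.d₁ ≠ 0 := by omega
    have hl1 : X.1.ell₁ < N := by
      have := ell₁_lt_N X (by simpa [RWObj.dd] using hd0); exact this
    have hla : X.1.ellA < N := lt_of_le_of_lt X.1.ellA_le_ell₁ hl1
    have h2 : (N ^ 2 - N) * X.1.ell₀ ≤ (N ^ 2 - N) * X.1.nn := Nat.mul_le_mul_left _ hl0
    have h3 : N ^ 2 * 1 ≤ N ^ 2 * X.1.nn := Nat.mul_le_mul_left _ hn1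
    have h5 : N ≤ N ^ 2 := by nlinarith
    have h4 : (N ^ 2 - N) * X.1.nn + N ^ 2 * X.1.nn = (2 * N ^ 2 - N) * X.1.nn := by
      rw [← Nat.add_mul]; congr 1; omega
    nlinarith
  -- `b_ε = 0` with `n = 0`: `(N²-N) d₀ + N² d₁ + κ_a ≤ 0`
  rw [hn] at hb
  have hk := X.1.kapA_eq_zero_of_nn hn
  have h6 : (N ^ 2 - N) * X.1.d₀ + N ^ 2 * X.1.d₁ = 0 := by rw [mul_zero, Nat.sub_zero] at hb; omega
  have hd₁ : X.1.d₁ = 0 := by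
    rcases Nat.mul_eq_zero.mp (show N ^ 2 * X.1.d₁ = 0 by omega) with h7 | h7
    · exact absurd h7 (by positivity)
    · exact h7
  have hd₀ : X.1.d₀ = 0 := by
    rcases Nat.lt_or_ge N 2 with hN2 | hN2
    · -- `N = 1`: the `𝒞_ε`-condition `2d(d+ℓ₁)+1 ≤ N = 1` forces `d = 0`
      have h8 : 2 * (X.1.d₀ + X.1.d₁) * (X.1.d₀ + X.1.d₁ + X.1.ell₁) = 0 := by omega
      rcases Nat.mul_eq_zero.mp h8 with h9 | h9
      · omega
      · omega
    · have : 1 ≤ N ^ 2 - N := by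
        have : N ^ 2 ≥ 2 * N := by nlinarith
        omega
      rcases Nat.mul_eq_zero.mp (show (N ^ 2 - N) * X.1.d₀ = 0 by omega) with h7 | h7
      · omega
      · exact h7
  rw [hd₀, hd₁]; simp

/-! ### Proposition 6.1 for `𝒞_ε` -/

/-- **Proposition 6.1 for the category `𝒞_ε`** (Roy–Waldschmidt p. 785, applied p. 788 (iv)): by
Lemme 6.3 the functions `a_ε, b_ε, c_ε, d_ε, r_ε` on `𝒞_ε` satisfy the hypotheses of Proposition
6.1, so ÉNONCÉ 1 implies ÉNONCÉ 2 — here via the proved relational form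
`RoyCategory.enonce2_of_enonce1`.  ÉNONCÉ 1: every `X` with `b(X) ≠ 0` has a cokernel `X → X'`
in `𝒞_ε` with `b(X') + d(X') ≠ 0` and `(a(X') + c(X'))·b(X) ≤ a(X)·(b(X') + d(X'))`.  ÉNONCÉ 2:
for `X` with `b(X) ≠ 0`, minimisers `X → X'` (`b(X') ≠ 0`, `a(X')/b(X')` minimal) exist, and for
such a minimiser with `r(X')` minimal, `c(X') ≠ 0 ⟹ d(X') ≠ 0 ∧ a/b(X) ≥ a/b(X') ≥ c/d(X')`.
[cite: RoyWaldschmidt1997ENS, Proposition 6.1 p. 785, Lemme 6.3 p. 788, §6 (iv) (b) p. 789] -/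
theorem enonce2_of_enonce1
    (h1 : ∀ X : Ceps K N, X.1.bE N ≠ 0 → ∃ X' : Ceps K N, Quot X X' ∧ X'.1.bE N + X'.1.dE N ≠ 0 ∧
      (X'.1.aE N + X'.1.cE N) * X.1.bE N ≤ X.1.aE N * (X'.1.bE N + X'.1.dE N))
    (X : Ceps K N) (hbX : X.1.bE N ≠ 0) :
    (∃ X₁ : Ceps K N, (Quot X X₁ ∧ X₁.1.bE N ≠ 0) ∧
      ∀ X', (Quot X X' ∧ X'.1.bE N ≠ 0) → X₁.1.aE N * X'.1.bE N ≤ X'.1.aE N * X₁.1.bE N) ∧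
    ∀ X₁ : Ceps K N, (Quot X X₁ ∧ X₁.1.bE N ≠ 0) →
      (∀ X', (Quot X X' ∧ X'.1.bE N ≠ 0) → X₁.1.aE N * X'.1.bE N ≤ X'.1.aE N * X₁.1.bE N) →
      (∀ X', (Quot X X' ∧ X'.1.bE N ≠ 0) →
        (∀ X'', (Quot X X'' ∧ X''.1.bE N ≠ 0) → X'.1.aE N * X''.1.bE N ≤ X''.1.aE N * X'.1.bE N) →
        X₁.1.rE N ≤ X'.1.rE N) →
      X₁.1.cE N ≠ 0 → X₁.1.dE N ≠ 0 ∧ X₁.1.aE N * X.1.bE N ≤ X.1.aE N * X₁.1.bE N ∧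
        X₁.1.cE N * X₁.1.bE N ≤ X₁.1.aE N * X₁.1.dE N :=
  RoyCategory.enonce2_of_enonce1 (Ob := Ceps K N) Quot SubO Exact
    (fun X => X.1.aE N) (fun X => X.1.bE N) (fun X => X.1.cE N) (fun X => X.1.dE N) (fun X => X.1.rE N)
    (fun X => X.1.rE N) (fun X => X.1.cE N)
    quot_refl subO_refl quot_trans subO_trans quot_exists_exact subO_exists_exact exact_quot exact_subO
    (fun Xs X X' h => rE_add Xs X X' h)
    (fun Xs X X' h => aE_superadd Xs X X' h)
    (fun Xs X X' h => bE_subadd Xs X X' h)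
    (fun Xs X X' h => (cE_add Xs X X' h).le)
    (fun Xs X X' h => dE_superadd Xs X X' h)
    bE_le_rE (fun Xs X X' h => (rE_add Xs X X' h).symm.le)
    (fun _ => le_rfl) (fun Xs X X' h => (cE_add Xs X X' h).symm.le)
    (fun X h => (vanish_of_rE X h).1) (fun X h => (vanish_of_rE X h).2)
    h1 X hbX

end Ceps

end RoyWaldschmidt1997

end Literature.NumberTheory.Transcendental
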